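import Literature.Probability.Percolation.ArmExponentsFourArm
import Literature.Probability.Percolation.ArmExponentsTwoArmProofs
import Literature.Probability.Percolation.ArmEventsAPrioriPoly
import HarnessLib

/-!
# The four-arm exponent: the continuum input on integer data, and the critical-only assembly

Topic `Literature/Probability/Percolation`; family `crit-perc`. Second companion of
`ArmExponents.lean` for the named fact `Literature.Probability.Percolation.fourArm_exponent`
(S. Smirnov, W. Werner, *Critical exponents for two-dimensional percolation*, Math. Res. Lett. 8
(2001) 729–744, Thm. 4 of the arXiv text `math/0109120`, `j = 4`: for every large enough `r₀`,
`P_{1/2}(armEvent ![T,F,T,F] r₀ R) = R^{-5/4 + o(1)}`), after `ArmExponentsFourArm.lean` (the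
proved assembly `fourArm_exponent_of_scaleBounds`: two-sided scale bounds (A) and the
quasi-multiplicativity (B) imply the fact) and `ArmEventsAPrioriPoly.lean` (the proved RSW a-priori
bounds for `π₄`). Theorems only: no definition, no named fact.

Smirnov–Werner's continuum input (A) consists of two printed statements (equation numbers of the
arXiv text, §4): **(16)** "`b_j(ρ r, ρ R)` has a scaling limit, which is conformally invariant, and
so depends on the ratio `R/r` only: `b'_j(R/r) = lim_ρ b_j(ρ r, ρ R)`" (Smirnov's theorem) and
**(9)** with (15): `b'_j(λ) = λ^{-(j²-1)/12 + o(1)}` (convergence of the exploration process to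
`SLE₆` and the `SLE₆` exponents of Lawler–Schramm–Werner; `(4² - 1)/12 = 5/4`). As for `j = 2` in
`ArmExponentsTwoArmProofs.lean`, we read both on **integer data** — (16)ℕ: the limits
`L(r, R) = lim_ρ π₄(ρ r, ρ R)` exist for all integers `1 ≤ r < R`; (9)ℕ: `log L(1, n) / log n → -5/4`
along the integers — and PROVE that this is all the assembly needs:

* `PolyArmScalingLimit.*` — for an ABSTRACT two-radius sequence `b` (non-increasing in the outer
  radius, at most `1`, with a scale-invariant power lower bound) with limits `L` along integer
  dilations: ratio-only dependence (`limit_mul`, `limit_eq_of_ratio_eq`: "depends on the ratio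
  only" is automatic along integer dilations), monotonicity (`limit_anti_right`, `limit_mono_left`,
  `limit_anti_ratio`), the lower bound and positivity in the limit (`le_limit_of_lowerBound`,
  `limit_pos`: SW p. 9, "`b'_j(R) ≥ const R^{-ζ}`"), and the transfer of the exponent from the
  ratios `n = R/1` to all integer pairs and to every fixed inner radius (`exponent_of_nat`,
  `tendsto_log_limit_div_log`; the sandwich `L(1, n+1) ≤ L(r, R) ≤ L(1, n)` for
  `n r ≤ R < (n+1) r` of `TwoArmScalingLimit.exponent_of_nat`).
* `ArmExponentAssembly.scaleBounds_of_natLimit` — the integer-data form of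
  `scaleBounds_of_ratioLimit`: limits `g(K)` of `b(4σ, Kσ)` with `log g(K) / log K → -α` give the
  two-sided scale bounds (A).
* `fourArm_exponent_of_scaleBounds_crit` — the assembly with (B) the quasi-multiplicativity AT
  `p = 1/2` ONLY (`c · π₄(r, R) · π₄(4R, S) ≤ π₄(r, S)`, SW (10); Werner 2009, Lecture 5), instead
  of the near-critical named fact `Werner2009_fourArm_quasiMult` (uniform below `L(p)`), of which
  it is the case `t = 1/2` (`critFourArmProb_quasiMult_of_fact`).
* `critFourArmProb_scaleBounds_of_limits_nat`, `fourArm_exponent_of_limits_nat_crit`,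
  `fourArm_exponent_of_limits_nat` — **(16)ℕ ∧ (9)ℕ ∧ (B) ⇒ `fourArm_exponent`**, with (B) in
  either form; `critFourArmProb_limit_bounds` — the a-priori bounds pass to the limits.

What remains for `fourArm_exponent_holds` is exactly: (16)ℕ for `j = 4` (Smirnov's theorem / the
Camia–Newman full scaling limit applied to the four-arm events of the integer annuli; cf. the
tree's named facts `convergesInLawToSLE_six_triInterface`, `exists_isCNLFamily_tendsto`), (9)ℕ for
`j = 4` (the `SLE₆` exponent `5/4`, SW (12)–(14), Lawler–Schramm–Werner), and the discharge of the
four-arm quasi-multiplicativity at `p = 1/2` (Kesten 1987; SW (10); Werner 2009, Lecture 5,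
Lemmas 5.1–5.2; in the tree the `t = 1/2` case of `Werner2009_fourArm_quasiMult`). None of the
three is proved here.

## References

* S. Smirnov, W. Werner, *Critical exponents for two-dimensional percolation*, Math. Res. Lett. 8
  (2001), 729–744; arXiv:math/0109120, Thm. 4, §4: (9), (10), (15), (16) and the sentence
  following (16) (p. 9 of the arXiv text); p. 5 (assembly) [SmirnovWernerMRL2001].
* W. Werner, *Lectures on two-dimensional critical percolation*, IAS/Park City Math. Ser. 16
  (2009), Lecture 5, Thm. 5.2, Lemmas 5.1–5.2; Lecture 6, Cor. 6.2 [WernerPCMI2009].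
* H. Kesten, *Scaling relations for 2D-percolation*, Comm. Math. Phys. 109 (1987) 109–156
  [KestenScalingCMP1987].

Mathlib: `Filter.Tendsto`, `tendsto_nhds_unique`, `le_of_tendsto_of_tendsto`, `ge_of_tendsto`,
`Metric.tendsto_atTop`, `Real.log`, `Real.rpow`. Tree: `critFourArmProb` (`KestenScaling.lean`),
`fourArm_exponent`, `Werner2009_fourArm_quasiMult`, `critFourArmProb_quasiMult_of_fact`,
`critFourArmProb_pos`, `ArmExponentAssembly.hasDecayExponent_of_scales`
(`ArmExponentsFourArm.lean`), `TwoArmScalingLimit.tendsto_log_succ_div_log`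
(`ArmExponentsTwoArmProofs.lean`), `TwoArmAssembly.div_le_div_of_nonpos_left'`
(`ArmExponentsTwoArm.lean`), `exists_rpow_le_polyArmProb_four`, `exists_polyArmProb_four_le_rpow`
(`ArmEventsAPrioriPoly.lean`), `polyArmProb_anti_holds`, `polyArmProb_submult`, `polyArmProb_le_one`,
`polyArmProb_nonneg` (`ArmEventsProofs.lean`).
-/

noncomputable section

open Filter Topology MeasureTheory

namespace Literature.Probability.Percolation

open LatticeModels

/-! ### Scaling limits of two-radius arm probabilities along integer dilations (abstract) -/

namespace PolyArmScalingLimit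

variable {b : ℕ → ℕ → ℝ} {L : ℕ → ℕ → ℝ}

/-- Along integer dilations the limits are automatically scale invariant: `b(ρ k r, ρ k R)` is a
subsequence of `b(ρ r, ρ R)`, so `L(k r, k R) = L(r, R)` (Smirnov–Werner 2001, (16): the scaling
limit "depends on the ratio `R/r` only"). [cite: SmirnovWernerMRL2001, §4 (16)] -/
theorem limit_mul
    (hlim : ∀ r R : ℕ, 1 ≤ r → r < R → Tendsto (fun ρ : ℕ => b (ρ * r) (ρ * R)) atTop (𝓝 (L r R)))
    {r R k : ℕ} (hr : 1 ≤ r) (hrR : r < R) (hk : 1 ≤ k) : L (k * r) (k * R) = L r R := by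
  have hkr : 1 ≤ k * r := le_trans hk (Nat.le_mul_of_pos_right k hr)
  have hkR : k * r < k * R := Nat.mul_lt_mul_of_pos_left hrR hk
  have h1 : Tendsto (fun ρ : ℕ => b (ρ * (k * r)) (ρ * (k * R))) atTop (𝓝 (L (k * r) (k * R))) :=
    hlim (k * r) (k * R) hkr hkR
  have hsub : Tendsto (fun ρ : ℕ => ρ * k) atTop atTop :=
    tendsto_atTop_mono (fun ρ => Nat.le_mul_of_pos_right ρ hk) tendsto_id
  have h2 : Tendsto (fun ρ : ℕ => b (ρ * (k * r)) (ρ * (k * R))) atTop (𝓝 (L r R)) := by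
    have h := (hlim r R hr hrR).comp hsub
    simpa only [Function.comp_def, mul_assoc] using h
  exact tendsto_nhds_unique h1 h2

/-- The limits depend on the ratio only: if `R r' = R' r` then `L(r, R) = L(r', R')`.
[cite: SmirnovWernerMRL2001, §4 (16)] -/
theorem limit_eq_of_ratio_eq
    (hlim : ∀ r R : ℕ, 1 ≤ r → r < R → Tendsto (fun ρ : ℕ => b (ρ * r) (ρ * R)) atTop (𝓝 (L r R)))
    {r R r' R' : ℕ} (hr : 1 ≤ r) (hrR : r < R) (hr' : 1 ≤ r') (hr'R' : r' < R')
    (h : R * r' = R' * r) : L r R = L r' R' := by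
  rw [← limit_mul hlim hr hrR hr', ← limit_mul hlim hr' hr'R' hr]
  rw [Nat.mul_comm r' r, Nat.mul_comm r' R, h, Nat.mul_comm R' r]

/-- The limits are non-increasing in the outer radius if `b` is (Smirnov–Werner 2001, §3:
"`a_j(r, R)` is decreasing in `R`"). [cite: SmirnovWernerMRL2001, §3] -/
theorem limit_anti_right
    (hlim : ∀ r R : ℕ, 1 ≤ r → r < R → Tendsto (fun ρ : ℕ => b (ρ * r) (ρ * R)) atTop (𝓝 (L r R)))
    (hanti : ∀ ⦃r R R' : ℕ⦄, r ≤ R → R ≤ R' → b r R' ≤ b r R)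
    {r R R' : ℕ} (hr : 1 ≤ r) (hrR : r < R) (hRR' : R ≤ R') : L r R' ≤ L r R :=
  le_of_tendsto_of_tendsto (hlim r R' hr (lt_of_lt_of_le hrR hRR')) (hlim r R hr hrR)
    (Eventually.of_forall fun ρ =>
      hanti (Nat.mul_le_mul_left ρ hrR.le) (Nat.mul_le_mul_left ρ hRR'))

/-- The limits are non-decreasing in the inner radius if `b` is. [cite: SmirnovWernerMRL2001, §3] -/
theorem limit_mono_left
    (hlim : ∀ r R : ℕ, 1 ≤ r → r < R → Tendsto (fun ρ : ℕ => b (ρ * r) (ρ * R)) atTop (𝓝 (L r R)))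
    (hmono : ∀ ⦃r r' R : ℕ⦄, r ≤ r' → r' ≤ R → b r R ≤ b r' R)
    {r r' R : ℕ} (hr : 1 ≤ r) (hrr' : r ≤ r') (hr'R : r' < R) : L r R ≤ L r' R :=
  le_of_tendsto_of_tendsto (hlim r R hr (lt_of_le_of_lt hrr' hr'R)) (hlim r' R (hr.trans hrr') hr'R)
    (Eventually.of_forall fun ρ =>
      hmono (Nat.mul_le_mul_left ρ hrr') (Nat.mul_le_mul_left ρ hr'R.le))

/-- The limits are non-increasing in the ratio: if `R r' ≤ R' r` then `L(r', R') ≤ L(r, R)`.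
[cite: SmirnovWernerMRL2001, §3 and §4 (16)] -/
theorem limit_anti_ratio
    (hlim : ∀ r R : ℕ, 1 ≤ r → r < R → Tendsto (fun ρ : ℕ => b (ρ * r) (ρ * R)) atTop (𝓝 (L r R)))
    (hanti : ∀ ⦃r R R' : ℕ⦄, r ≤ R → R ≤ R' → b r R' ≤ b r R)
    {r R r' R' : ℕ} (hr : 1 ≤ r) (hrR : r < R) (hr' : 1 ≤ r') (hr'R' : r' < R')
    (h : R * r' ≤ R' * r) : L r' R' ≤ L r R := by
  rw [← limit_mul hlim hr hrR hr', ← limit_mul hlim hr' hr'R' hr]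
  have hrr' : 1 ≤ r * r' := le_trans hr (Nat.le_mul_of_pos_right r hr')
  have hlt : r * r' < r' * R := by
    rw [Nat.mul_comm r r']
    exact Nat.mul_lt_mul_of_pos_left hrR hr'
  have hle : r' * R ≤ r * R' := by
    rw [Nat.mul_comm r' R, Nat.mul_comm r R']
    exact h
  have := limit_anti_right hlim hanti hrr' hlt hle
  rwa [Nat.mul_comm r r'] at this ⊢

/-- **A scale-invariant lower bound passes to the limit** (Smirnov–Werner 2001, sentence following
(16): "By standard RSW theory, `b_j(r, R)` is bounded from below by a power of `R/r`, hence
`b'_j(R) ≥ const R^{-ζ}`"): if `c (r/R)^ζ ≤ b(r, R)` for `n₀ ≤ r ≤ R`, then `c (r/R)^ζ ≤ L(r, R)`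
for all `1 ≤ r < R`. [cite: SmirnovWernerMRL2001, §4.2 (sentence following (16), p. 9)] -/
theorem le_limit_of_lowerBound
    (hlim : ∀ r R : ℕ, 1 ≤ r → r < R → Tendsto (fun ρ : ℕ => b (ρ * r) (ρ * R)) atTop (𝓝 (L r R)))
    {c ζ : ℝ} {n₀ : ℕ} (hlow : ∀ r R : ℕ, n₀ ≤ r → r ≤ R → c * ((r : ℝ) / R) ^ ζ ≤ b r R)
    {r R : ℕ} (hr : 1 ≤ r) (hrR : r < R) : c * ((r : ℝ) / R) ^ ζ ≤ L r R := by
  refine ge_of_tendsto (hlim r R hr hrR) ?_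
  filter_upwards [eventually_ge_atTop (max n₀ 1)] with ρ hρ
  have hρ1 : 1 ≤ ρ := le_trans (le_max_right _ _) hρ
  have hρn : n₀ ≤ ρ * r := le_trans (le_trans (le_max_left _ _) hρ) (Nat.le_mul_of_pos_right ρ hr)
  have hb := hlow (ρ * r) (ρ * R) hρn (Nat.mul_le_mul_left ρ hrR.le)
  have hρ' : (0 : ℝ) < ρ := by exact_mod_cast hρ1
  have hcast : (((ρ * r : ℕ) : ℝ) / ((ρ * R : ℕ) : ℝ)) = (r : ℝ) / R := by
    push_cast
    rw [mul_div_mul_left _ _ hρ'.ne']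
  rwa [hcast] at hb

/-- The limits are positive (under a positive scale-invariant lower bound). [cite: SmirnovWernerMRL2001, §4.2 (sentence following (16), p. 9)] -/
theorem limit_pos
    (hlim : ∀ r R : ℕ, 1 ≤ r → r < R → Tendsto (fun ρ : ℕ => b (ρ * r) (ρ * R)) atTop (𝓝 (L r R)))
    {c ζ : ℝ} {n₀ : ℕ} (hc : 0 < c)
    (hlow : ∀ r R : ℕ, n₀ ≤ r → r ≤ R → c * ((r : ℝ) / R) ^ ζ ≤ b r R)
    {r R : ℕ} (hr : 1 ≤ r) (hrR : r < R) : 0 < L r R := by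
  have hr' : (0 : ℝ) < r := by exact_mod_cast hr
  have hR' : (0 : ℝ) < R := by exact_mod_cast (lt_of_le_of_lt (Nat.zero_le r) hrR)
  exact lt_of_lt_of_le (mul_pos hc (Real.rpow_pos_of_pos (div_pos hr' hR') ζ))
    (le_limit_of_lowerBound hlim hlow hr hrR)

/-- The limits are at most `1` if `b` is. [folklore] -/
theorem limit_le_one
    (hlim : ∀ r R : ℕ, 1 ≤ r → r < R → Tendsto (fun ρ : ℕ => b (ρ * r) (ρ * R)) atTop (𝓝 (L r R)))
    (hb1 : ∀ r R, b r R ≤ 1) {r R : ℕ} (hr : 1 ≤ r) (hrR : r < R) : L r R ≤ 1 :=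
  le_of_tendsto' (hlim r R hr hrR) fun _ => hb1 _ _

/-- **The exponent transfers from integer ratios to all integer pairs** (monotonicity sandwich
`L(1, n+1) ≤ L(r, R) ≤ L(1, n)` for `n r ≤ R < (n+1) r`): if `log L(1, n) / log n → -α` along the
integers, then for every `ε > 0` there is `M` with `|log L(r, R) / log (R/r) + α| < ε` for all
integers `1 ≤ r < R` with `R ≥ M r`. (The argument of `TwoArmScalingLimit.exponent_of_nat`, for an
abstract two-radius sequence.) [cite: SmirnovWernerMRL2001, §4 (9), (16)] -/
theorem exponent_of_nat
    (hlim : ∀ r R : ℕ, 1 ≤ r → r < R → Tendsto (fun ρ : ℕ => b (ρ * r) (ρ * R)) atTop (𝓝 (L r R)))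
    (hanti : ∀ ⦃r R R' : ℕ⦄, r ≤ R → R ≤ R' → b r R' ≤ b r R) (hb1 : ∀ r R, b r R ≤ 1)
    {c ζ : ℝ} {n₀ : ℕ} (hc : 0 < c)
    (hlow : ∀ r R : ℕ, n₀ ≤ r → r ≤ R → c * ((r : ℝ) / R) ^ ζ ≤ b r R)
    {α : ℝ} (hexp : Tendsto (fun n : ℕ => Real.log (L 1 n) / Real.log n) atTop (𝓝 (-α))) :
    ∀ ε > 0, ∃ M : ℕ, ∀ r R : ℕ, 1 ≤ r → r < R → M * r ≤ R →
      |Real.log (L r R) / Real.log ((R : ℝ) / r) - (-α)| < ε := by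
  intro ε hε
  have hu : Tendsto (fun n : ℕ => Real.log (L 1 n) / Real.log ((n : ℝ) + 1)) atTop (𝓝 (-α)) := by
    have h := hexp.div TwoArmScalingLimit.tendsto_log_succ_div_log one_ne_zero
    rw [div_one] at h
    refine h.congr' ?_
    filter_upwards [eventually_ge_atTop 2] with n hn
    have hn' : (2 : ℝ) ≤ n := by exact_mod_cast hn
    have hlog : Real.log (n : ℝ) ≠ 0 := ne_of_gt (Real.log_pos (by linarith))
    have hlog1 : Real.log ((n : ℝ) + 1) ≠ 0 := ne_of_gt (Real.log_pos (by linarith))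
    simp only [Pi.div_apply]
    field_simp
  have hv : Tendsto (fun n : ℕ => Real.log (L 1 (n + 1)) / Real.log n) atTop (𝓝 (-α)) := by
    have h1 : Tendsto (fun n : ℕ => Real.log (L 1 (n + 1)) / Real.log ((n : ℝ) + 1)) atTop
        (𝓝 (-α)) := by
      have h := hexp.comp (tendsto_add_atTop_nat 1)
      simpa only [Function.comp_def, Nat.cast_succ] using h
    have h := h1.mul TwoArmScalingLimit.tendsto_log_succ_div_log
    rw [mul_one] at h
    refine h.congr' ?_
    filter_upwards [eventually_ge_atTop 2] with n hn
    have hn' : (2 : ℝ) ≤ n := by exact_mod_cast hn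
    have hlog : Real.log (n : ℝ) ≠ 0 := ne_of_gt (Real.log_pos (by linarith))
    have hlog1 : Real.log ((n : ℝ) + 1) ≠ 0 := ne_of_gt (Real.log_pos (by linarith))
    field_simp
  obtain ⟨M, hM⟩ := eventually_atTop.1
    (((Metric.tendsto_nhds.1 hu) ε hε).and ((((Metric.tendsto_nhds.1 hv) ε hε)).and
      (eventually_ge_atTop 2)))
  refine ⟨M, fun r R hr hrR hMR => ?_⟩
  have hr0 : 0 < r := hr
  set n : ℕ := R / r with hn_def
  have hMn : M ≤ n := (Nat.le_div_iff_mul_le hr0).2 hMR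
  obtain ⟨hun, hvn, hn2⟩ := hM n hMn
  have hnr : n * r ≤ R := Nat.div_mul_le_self R r
  have hRn : R < (n + 1) * r := (Nat.div_lt_iff_lt_mul hr0).1 (Nat.lt_succ_self _)
  have hn1 : 1 < n := hn2
  have hn1' : 1 < n + 1 := by omega
  have hup : L r R ≤ L 1 n :=
    limit_anti_ratio hlim hanti le_rfl hn1 hr hrR (by simpa [Nat.mul_one] using hnr)
  have hlow' : L 1 (n + 1) ≤ L r R :=
    limit_anti_ratio hlim hanti hr hrR le_rfl hn1' (by simpa [Nat.mul_one] using hRn.le)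
  have hpos : 0 < L r R := limit_pos hlim hc hlow hr hrR
  have hpos1 : 0 < L 1 (n + 1) := limit_pos hlim hc hlow le_rfl hn1'
  have hle1 : L 1 n ≤ 1 := limit_le_one hlim hb1 le_rfl hn1
  have hlog_up : Real.log (L r R) ≤ Real.log (L 1 n) := Real.log_le_log hpos hup
  have hlog_low : Real.log (L 1 (n + 1)) ≤ Real.log (L r R) := Real.log_le_log hpos1 hlow'
  have hlogn_nonpos : Real.log (L 1 n) ≤ 0 := Real.log_nonpos (hpos.trans_le hup).le hle1
  have hlogn1_nonpos : Real.log (L 1 (n + 1)) ≤ 0 :=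
    Real.log_nonpos hpos1.le (hlow'.trans (hup.trans hle1))
  have hr' : (0 : ℝ) < r := by exact_mod_cast hr
  have hn' : (2 : ℝ) ≤ n := by exact_mod_cast hn2
  have hratio_ge : (n : ℝ) ≤ (R : ℝ) / r := by
    rw [le_div_iff₀ hr']
    exact_mod_cast hnr
  have hratio_le : (R : ℝ) / r ≤ (n : ℝ) + 1 := by
    rw [div_le_iff₀ hr']
    exact_mod_cast hRn.le
  have hlogn_pos : 0 < Real.log (n : ℝ) := Real.log_pos (by linarith)
  have hlogq_ge : Real.log (n : ℝ) ≤ Real.log ((R : ℝ) / r) :=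
    Real.log_le_log (by linarith) hratio_ge
  have hlogq_le : Real.log ((R : ℝ) / r) ≤ Real.log ((n : ℝ) + 1) :=
    Real.log_le_log (by linarith) hratio_le
  have hlogq_pos : 0 < Real.log ((R : ℝ) / r) := hlogn_pos.trans_le hlogq_ge
  have h_upper : Real.log (L r R) / Real.log ((R : ℝ) / r)
      ≤ Real.log (L 1 n) / Real.log ((n : ℝ) + 1) :=
    calc Real.log (L r R) / Real.log ((R : ℝ) / r)
        ≤ Real.log (L 1 n) / Real.log ((R : ℝ) / r) :=
          div_le_div_of_nonneg_right hlog_up hlogq_pos.le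
      _ ≤ Real.log (L 1 n) / Real.log ((n : ℝ) + 1) :=
          TwoArmAssembly.div_le_div_of_nonpos_left' hlogn_nonpos hlogq_pos hlogq_le
  have h_lower : Real.log (L 1 (n + 1)) / Real.log (n : ℝ)
      ≤ Real.log (L r R) / Real.log ((R : ℝ) / r) :=
    calc Real.log (L 1 (n + 1)) / Real.log (n : ℝ)
        ≤ Real.log (L 1 (n + 1)) / Real.log ((R : ℝ) / r) :=
          TwoArmAssembly.div_le_div_of_nonpos_left' hlogn1_nonpos hlogn_pos hlogq_ge
      _ ≤ Real.log (L r R) / Real.log ((R : ℝ) / r) :=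
          div_le_div_of_nonneg_right hlog_low hlogq_pos.le
  rw [Real.dist_eq] at hun hvn
  rw [abs_sub_lt_iff] at hun hvn ⊢
  constructor <;> linarith [hun.1, hun.2, hvn.1, hvn.2]

/-- **The exponent at a fixed inner radius**: under the hypotheses of `exponent_of_nat`, for every
fixed `r ≥ 1`, `log L(r, K) / log K → -α` as `K → ∞` (`log (K/r) / log K → 1`). [cite: SmirnovWernerMRL2001, §4 (9), (16)] -/
theorem tendsto_log_limit_div_log
    (hlim : ∀ r R : ℕ, 1 ≤ r → r < R → Tendsto (fun ρ : ℕ => b (ρ * r) (ρ * R)) atTop (𝓝 (L r R)))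
    (hanti : ∀ ⦃r R R' : ℕ⦄, r ≤ R → R ≤ R' → b r R' ≤ b r R) (hb1 : ∀ r R, b r R ≤ 1)
    {c ζ : ℝ} {n₀ : ℕ} (hc : 0 < c)
    (hlow : ∀ r R : ℕ, n₀ ≤ r → r ≤ R → c * ((r : ℝ) / R) ^ ζ ≤ b r R)
    {α : ℝ} (hexp : Tendsto (fun n : ℕ => Real.log (L 1 n) / Real.log n) atTop (𝓝 (-α)))
    {r : ℕ} (hr : 1 ≤ r) :
    Tendsto (fun K : ℕ => Real.log (L r K) / Real.log K) atTop (𝓝 (-α)) := by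
  have hr' : (0 : ℝ) < r := by exact_mod_cast hr
  -- `log L(r, K) / log (K/r) → -α`
  have h1 : Tendsto (fun K : ℕ => Real.log (L r K) / Real.log ((K : ℝ) / r)) atTop (𝓝 (-α)) := by
    rw [Metric.tendsto_atTop]
    intro ε hε
    obtain ⟨M, hM⟩ := exponent_of_nat hlim hanti hb1 hc hlow hexp ε hε
    refine ⟨max (M * r) (r + 1), fun K hK => ?_⟩
    have hMK : M * r ≤ K := le_trans (le_max_left _ _) hK
    have hrK : r < K := lt_of_lt_of_le (Nat.lt_succ_self r) (le_trans (le_max_right _ _) hK)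
    rw [Real.dist_eq]
    exact hM r K hr hrK hMK
  -- `log (K/r) / log K → 1`
  have hlogK : Tendsto (fun K : ℕ => Real.log (K : ℝ)) atTop atTop :=
    Real.tendsto_log_atTop.comp tendsto_natCast_atTop_atTop
  have h2 : Tendsto (fun K : ℕ => Real.log ((K : ℝ) / r) / Real.log (K : ℝ)) atTop (𝓝 1) := by
    have h : Tendsto (fun K : ℕ => 1 - Real.log r / Real.log (K : ℝ)) atTop (𝓝 (1 - 0)) :=
      tendsto_const_nhds.sub (tendsto_const_nhds.div_atTop hlogK)
    rw [sub_zero] at h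
    refine h.congr' ?_
    filter_upwards [eventually_ge_atTop 2] with K hK
    have hK' : (2 : ℝ) ≤ K := by exact_mod_cast hK
    have hlog : Real.log (K : ℝ) ≠ 0 := ne_of_gt (Real.log_pos (by linarith))
    rw [Real.log_div (by positivity) hr'.ne']
    field_simp
  have h := h1.mul h2
  rw [mul_one] at h
  refine h.congr' ?_
  filter_upwards [eventually_ge_atTop (2 * r)] with K hK
  have hK' : (2 : ℝ) * r ≤ K := by exact_mod_cast hK
  have hr1 : (1 : ℝ) ≤ r := by exact_mod_cast hr
  have hKr : (2 : ℝ) ≤ (K : ℝ) / r := by rw [le_div_iff₀ hr']; linarith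
  have hlog : Real.log ((K : ℝ) / r) ≠ 0 := ne_of_gt (Real.log_pos (by linarith))
  have hlog' : Real.log (K : ℝ) ≠ 0 := ne_of_gt (Real.log_pos (by nlinarith))
  field_simp

end PolyArmScalingLimit

/-! ### Scale bounds from limits along integer ratios (abstract assembly) -/

namespace ArmExponentAssembly

/-- From limits along the integer annuli of fixed ratio — `b(4σ, Kσ) → g(K)` as `σ → ∞` for every
integer `K > 4`, with `log g(K) / log K → -α` along the integers — to the two-sided scale bounds (A)
of `hasDecayExponent_of_scales`: for every `ε > 0`, for all large `K` and then all large `σ`,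
`K^{-α-ε} ≤ b(4σ, Kσ) ≤ K^{-α+ε}` (the integer-data form of `scaleBounds_of_ratioLimit`; `g ≥ 0` as
a limit of nonnegative terms and `g(K) > 0` for large `K` since `log 0 = 0`). [cite: SmirnovWernerMRL2001, §4 (9) and (16)] -/
theorem scaleBounds_of_natLimit (b : ℕ → ℕ → ℝ) (hb0 : ∀ r R, 0 ≤ b r R) (g : ℕ → ℝ)
    (hlim : ∀ K : ℕ, 4 < K → Tendsto (fun σ : ℕ => b (σ * 4) (σ * K)) atTop (𝓝 (g K)))
    {α : ℝ} (hα : 0 < α) (hexp : Tendsto (fun K : ℕ => Real.log (g K) / Real.log K) atTop (𝓝 (-α))) :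
    ∀ ε : ℝ, 0 < ε → ∀ᶠ K : ℕ in atTop, ∀ᶠ σ : ℕ in atTop,
      (K : ℝ) ^ (-α - ε) ≤ b (σ * 4) (σ * K) ∧ b (σ * 4) (σ * K) ≤ (K : ℝ) ^ (-α + ε) := by
  -- it suffices to treat small `ε`
  suffices key : ∀ ε : ℝ, 0 < ε → ε < α → ∀ᶠ K : ℕ in atTop, ∀ᶠ σ : ℕ in atTop,
      (K : ℝ) ^ (-α - ε) ≤ b (σ * 4) (σ * K) ∧ b (σ * 4) (σ * K) ≤ (K : ℝ) ^ (-α + ε) by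
    intro ε hε
    have hε' : 0 < min ε (α / 2) := lt_min hε (by linarith)
    have hε'' : min ε (α / 2) < α := lt_of_le_of_lt (min_le_right _ _) (by linarith)
    filter_upwards [key _ hε' hε'', eventually_ge_atTop 1] with K hK hK1
    have hK1' : (1 : ℝ) ≤ K := by exact_mod_cast hK1
    refine hK.mono fun σ hσ => ⟨le_trans ?_ hσ.1, hσ.2.trans ?_⟩
    · exact Real.rpow_le_rpow_of_exponent_le hK1' (by linarith [min_le_left ε (α / 2)])
    · exact Real.rpow_le_rpow_of_exponent_le hK1' (by linarith [min_le_left ε (α / 2)])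
  intro ε hε hεα
  have hup : ∀ᶠ K : ℕ in atTop, Real.log (g K) / Real.log K < -α + ε / 2 :=
    hexp.eventually_lt_const (by linarith)
  have hlow : ∀ᶠ K : ℕ in atTop, -α - ε / 2 < Real.log (g K) / Real.log K :=
    hexp.eventually_const_lt (by linarith)
  filter_upwards [hup, hlow, eventually_gt_atTop 4] with K hKup hKlow hK4
  have hKR : (5 : ℝ) ≤ K := by exact_mod_cast hK4
  have hKpos : (0 : ℝ) < K := by linarith
  have hlogKpos : 0 < Real.log (K : ℝ) := Real.log_pos (by linarith)
  have hlimK : Tendsto (fun ρ : ℕ => b (ρ * 4) (ρ * K)) atTop (𝓝 (g K)) := hlim K hK4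
  have hg0 : 0 ≤ g K := ge_of_tendsto' hlimK fun ρ => hb0 _ _
  have hup' : Real.log (g K) < (-α + ε / 2) * Real.log K := (div_lt_iff₀ hlogKpos).1 hKup
  have hlow' : (-α - ε / 2) * Real.log K < Real.log (g K) := (lt_div_iff₀ hlogKpos).1 hKlow
  have hneg : Real.log (g K) < 0 := hup'.trans (mul_neg_of_neg_of_pos (by linarith) hlogKpos)
  have hgpos : 0 < g K := by
    rcases hg0.lt_or_eq with h | h
    · exact h
    · exfalso
      rw [← h, Real.log_zero] at hneg
      exact lt_irrefl _ hneg
  have hU : g K < (K : ℝ) ^ (-α + ε / 2) := by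
    rw [← Real.log_lt_log_iff hgpos (Real.rpow_pos_of_pos hKpos _), Real.log_rpow hKpos]
    exact hup'
  have hL : (K : ℝ) ^ (-α - ε / 2) < g K := by
    rw [← Real.log_lt_log_iff (Real.rpow_pos_of_pos hKpos _) hgpos, Real.log_rpow hKpos]
    exact hlow'
  have hK1 : (1 : ℝ) ≤ K := by linarith
  filter_upwards [hlimK.eventually_lt_const hU, hlimK.eventually_const_lt hL] with σ hσU hσL
  refine ⟨le_trans ?_ hσL.le, hσU.le.trans ?_⟩
  · exact Real.rpow_le_rpow_of_exponent_le hK1 (by linarith)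
  · exact Real.rpow_le_rpow_of_exponent_le hK1 (by linarith)

end ArmExponentAssembly

/-! ### The four-arm exponent: critical-only assembly and the continuum input on integer data -/

/-- **Assembly of the four-arm exponent with quasi-multiplicativity at `p = 1/2` only.** The
variant of `fourArm_exponent_of_scaleBounds` in which hypothesis (B) is the critical
quasi-multiplicativity `c · π₄(r, R) · π₄(4R, S) ≤ π₄(r, S)` (`n₀ ≤ r`, `16 r < 4R < S`; Werner 2009,
Lecture 5, Lemmas 5.1–5.2 at `p = 1/2`; Smirnov–Werner 2001, (10)) instead of the near-critical
named fact `Werner2009_fourArm_quasiMult` (Lecture 6, Cor. 6.2, uniform below `L(p)`), of which it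
is the `t = 1/2` case (`critFourArmProb_quasiMult_of_fact`). [cite: SmirnovWernerMRL2001, Thm. 4 (j = 4), §4 (10) and p. 5] [cite: WernerPCMI2009, Lecture 5, Thm. 5.2] -/
theorem fourArm_exponent_of_scaleBounds_crit
    (hA : ∀ ε : ℝ, 0 < ε → ∀ᶠ K : ℕ in atTop, ∀ᶠ σ : ℕ in atTop,
      (K : ℝ) ^ (-(5 / 4 : ℝ) - ε) ≤ critFourArmProb (σ * 4) (σ * K) ∧
        critFourArmProb (σ * 4) (σ * K) ≤ (K : ℝ) ^ (-(5 / 4 : ℝ) + ε))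
    (hB : ∃ n₀ : ℕ, ∃ c > (0 : ℝ), ∀ ⦃r R S : ℕ⦄, n₀ ≤ r → 16 * r < 4 * R → 4 * R < S →
      c * (critFourArmProb r R * critFourArmProb (4 * R) S) ≤ critFourArmProb r S) :
    fourArm_exponent := by
  obtain ⟨n₀, c, hc, hqm⟩ := hB
  refine ⟨max 1 n₀, fun r₀ hr₀ => ?_⟩
  have hr₀1 : 1 ≤ r₀ := le_trans (le_max_left _ _) hr₀
  have hr₀n : n₀ ≤ r₀ := le_trans (le_max_right _ _) hr₀
  exact ArmExponentAssembly.hasDecayExponent_of_scales (fun r R => critFourArmProb r R)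
    (fun r R => polyArmProb_nonneg _ r R) (fun r R => polyArmProb_le_one _ r R)
    (fun r R R' hr hR => polyArmProb_anti_holds _ hr hR)
    (fun n₁ n₂ n₃ h₁₂ h₂₃ => polyArmProb_submult _ h₁₂ h₂₃)
    (fun r R hr hR => critFourArmProb_pos hr hR) hc hqm (by norm_num) hA hr₀1 hr₀n

/-- **Scale bounds for `π₄` from Smirnov–Werner's (16) and (9) on integer data.** If the critical
four-arm probabilities of the integer annuli converge, `π₄(ρ r, ρ R) → L(r, R)` as `ρ → ∞` for all
integers `1 ≤ r < R` (SW (16): "`b_j(ρ r, ρ R)` has a scaling limit", Smirnov's theorem), and the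
limits along `r = 1` have exponent `-5/4`, `log L(1, n) / log n → -5/4` (SW (9) with (15), `j = 4`:
the `SLE₆` computation), then the two-sided scale bounds (A) of the assembly hold for `π₄`
(monotonicity `polyArmProb_anti_holds`, the a-priori RSW lower bound
`exists_rpow_le_polyArmProb_four`, `PolyArmScalingLimit.tendsto_log_limit_div_log`,
`ArmExponentAssembly.scaleBounds_of_natLimit`). [cite: SmirnovWernerMRL2001, §4 (9), (15), (16)] -/
theorem critFourArmProb_scaleBounds_of_limits_nat (L : ℕ → ℕ → ℝ)
    (hlim : ∀ r R : ℕ, 1 ≤ r → r < R →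
      Tendsto (fun ρ : ℕ => critFourArmProb (ρ * r) (ρ * R)) atTop (𝓝 (L r R)))
    (hexp : Tendsto (fun n : ℕ => Real.log (L 1 n) / Real.log n) atTop (𝓝 (-(5 / 4)))) :
    ∀ ε : ℝ, 0 < ε → ∀ᶠ K : ℕ in atTop, ∀ᶠ σ : ℕ in atTop,
      (K : ℝ) ^ (-(5 / 4 : ℝ) - ε) ≤ critFourArmProb (σ * 4) (σ * K) ∧
        critFourArmProb (σ * 4) (σ * K) ≤ (K : ℝ) ^ (-(5 / 4 : ℝ) + ε) := by
  obtain ⟨c, ζ, hc, -, hlow⟩ := exists_rpow_le_polyArmProb_four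
  have hanti : ∀ ⦃r R R' : ℕ⦄, r ≤ R → R ≤ R' → critFourArmProb r R' ≤ critFourArmProb r R :=
    fun r R R' hr hR => polyArmProb_anti_holds _ hr hR
  have h4 : Tendsto (fun K : ℕ => Real.log (L 4 K) / Real.log K) atTop (𝓝 (-(5 / 4))) :=
    PolyArmScalingLimit.tendsto_log_limit_div_log hlim hanti (fun r R => polyArmProb_le_one _ r R)
      hc hlow hexp (by norm_num)
  exact ArmExponentAssembly.scaleBounds_of_natLimit (fun r R => critFourArmProb r R)
    (fun r R => polyArmProb_nonneg _ r R) (fun K => L 4 K) (fun K hK => hlim 4 K (by norm_num) hK)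
    (by norm_num) h4

/-- **The four-arm exponent from (16)ℕ, (9)ℕ and quasi-multiplicativity at `p = 1/2`**
(Smirnov–Werner 2001, Thm. 4 for `j = 4`, from the two observations of §4, read on integer data):
IF `π₄(ρ r, ρ R) → L(r, R)` for all integers `1 ≤ r < R` (SW (16), Smirnov's theorem / the full
scaling limit) and `log L(1, n) / log n → -5/4` (SW (9) with (15): the `SLE₆` exponent
`(4² - 1)/12 = 5/4` of Lawler–Schramm–Werner), and π₄ is quasi-multiplicative at `p = 1/2`
(SW (10); Kesten 1987), THEN `fourArm_exponent` holds. What remains for `fourArm_exponent_holds` is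
exactly these three inputs. [cite: SmirnovWernerMRL2001, Thm. 4 (j = 4), §4 (9), (10), (15), (16)] -/
theorem fourArm_exponent_of_limits_nat_crit (L : ℕ → ℕ → ℝ)
    (hlim : ∀ r R : ℕ, 1 ≤ r → r < R →
      Tendsto (fun ρ : ℕ => critFourArmProb (ρ * r) (ρ * R)) atTop (𝓝 (L r R)))
    (hexp : Tendsto (fun n : ℕ => Real.log (L 1 n) / Real.log n) atTop (𝓝 (-(5 / 4))))
    (hB : ∃ n₀ : ℕ, ∃ c > (0 : ℝ), ∀ ⦃r R S : ℕ⦄, n₀ ≤ r → 16 * r < 4 * R → 4 * R < S →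
      c * (critFourArmProb r R * critFourArmProb (4 * R) S) ≤ critFourArmProb r S) :
    fourArm_exponent :=
  fourArm_exponent_of_scaleBounds_crit (critFourArmProb_scaleBounds_of_limits_nat L hlim hexp) hB

/-- **The four-arm exponent from (16)ℕ, (9)ℕ and `Werner2009_fourArm_quasiMult`**: the same with
the quasi-multiplicativity read off from the tree's near-critical named fact at `t = 1/2`
(`critFourArmProb_quasiMult_of_fact`). [cite: SmirnovWernerMRL2001, Thm. 4 (j = 4), §4 (9), (10), (16)] [cite: WernerPCMI2009, Lecture 6, Cor. 6.2] -/
theorem fourArm_exponent_of_limits_nat (L : ℕ → ℕ → ℝ)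
    (hlim : ∀ r R : ℕ, 1 ≤ r → r < R →
      Tendsto (fun ρ : ℕ => critFourArmProb (ρ * r) (ρ * R)) atTop (𝓝 (L r R)))
    (hexp : Tendsto (fun n : ℕ => Real.log (L 1 n) / Real.log n) atTop (𝓝 (-(5 / 4))))
    (hB : Werner2009_fourArm_quasiMult) : fourArm_exponent :=
  fourArm_exponent_of_limits_nat_crit L hlim hexp (critFourArmProb_quasiMult_of_fact hB)

/-- **Positivity and a-priori bounds of the four-arm scaling limits** (Smirnov–Werner 2001, §4.2,
sentence following (16): "`b'_j(R) ≥ const R^{-ζ}`"): if `π₄(ρ r, ρ R) → L(r, R)` for all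
`1 ≤ r < R`, then `c (r/R)^ζ ≤ L(r, R) ≤ C (r/R)^α` with the constants of
`exists_rpow_le_polyArmProb_four` and `exists_polyArmProb_four_le_rpow`; in particular
`0 < L(r, R) ≤ 1`. [cite: SmirnovWernerMRL2001, §4.2 (sentence following (16), p. 9)] -/
theorem critFourArmProb_limit_bounds (L : ℕ → ℕ → ℝ)
    (hlim : ∀ r R : ℕ, 1 ≤ r → r < R →
      Tendsto (fun ρ : ℕ => critFourArmProb (ρ * r) (ρ * R)) atTop (𝓝 (L r R))) :
    (∃ c ζ : ℝ, 0 < c ∧ 0 < ζ ∧ ∀ r R : ℕ, 1 ≤ r → r < R → c * ((r : ℝ) / R) ^ ζ ≤ L r R) ∧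
    (∃ C α : ℝ, 0 < C ∧ 0 < α ∧ ∀ r R : ℕ, 1 ≤ r → r < R → L r R ≤ C * ((r : ℝ) / R) ^ α) := by
  constructor
  · obtain ⟨c, ζ, hc, hζ, hlow⟩ := exists_rpow_le_polyArmProb_four
    exact ⟨c, ζ, hc, hζ, fun r R hr hrR => PolyArmScalingLimit.le_limit_of_lowerBound hlim hlow hr hrR⟩
  · obtain ⟨C, α, hC, hα, hup⟩ := exists_polyArmProb_four_le_rpow
    refine ⟨C, α, hC, hα, fun r R hr hrR => le_of_tendsto (hlim r R hr hrR) ?_⟩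
    filter_upwards [eventually_ge_atTop 1] with ρ hρ
    have hρr : 1 ≤ ρ * r := le_trans hρ (Nat.le_mul_of_pos_right ρ hr)
    have hb := hup (ρ * r) (ρ * R) hρr (Nat.mul_le_mul_left ρ hrR.le)
    have hρ' : (0 : ℝ) < ρ := by exact_mod_cast hρ
    have hcast : (((ρ * r : ℕ) : ℝ) / ((ρ * R : ℕ) : ℝ)) = (r : ℝ) / R := by
      push_cast
      rw [mul_div_mul_left _ _ hρ'.ne']
    rwa [hcast] at hb

end Literature.Probability.Percolation
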